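import Summits.BirchSwinnertonDyer.BirchSwinnertonDyer.Theorems.PrintCf2DisegniPairTwoQuotientLawValuation
import Summits.BirchSwinnertonDyer.BirchSwinnertonDyer.Theorems.PrintCf2DisegniPairTwoCompanionValueChi4
import Summits.BirchSwinnertonDyer.BirchSwinnertonDyer.Theorems.PrintCf2DisegniPairTwoCompanionValueChi8Prime
import HarnessLib

/-!
# Road (C) `disegni-pair-two` on crux stmt-BirchSwinnertonDyer-20368 — the quotient law in `ℚ₂` and its INTEGER
# VALUATION EQUATION on the ODD lines `χ₋₄∘N` (`d* = −1`) and `χ₋₈∘N` (`d* = −2`)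

Cell `bsd-print-cf2`, width seat `bsd-line-cf2-p1-w8` g23; sequel of `PrintCf2DisegniPairTwoQuotientLawValuation.lean`
(`quotient_law_descends`, `valuation_eq_of_rat_mul_eq`, `v₂(log₂γ) = 2`, the even line `χ₈∘N`).
`--supports stmt-BirchSwinnertonDyer-20368` (helper). THEOREMS ONLY (no `def`, no named fact, no `sorry`); conditional
on every displayed hypothesis. BSD is not proved by any of this; no summit statement is claimed; 20368 not closed.

Substituting `Z° = u·(ι(α)⁻ⁿ·τ(χ))²` (`zCirc_baseChangeDirichlet_of_isPrimitive`, `χ⁻¹ = χ`) into -w8 g22's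
`quotient_law_chi4_companion_free` / `quotient_law_chi8'_companion_free` and cancelling `u`, one `τ(χ)`, `α⁻ⁿ`:
* §4 (`d* = −1`, `n = 2`, `x = i`, `Ω = Ω⁻_f`, `D = [T¹]L₂⁻(f,ω,T)`): ★★ `quotient_law_chi4_padic` — under
  `hρ : L′(W,1)·τ(χ₋₄)·i = ρ·ĥ(P)·Ω⁻_f`, `ρ ∈ ℚ`: `∃ σ = ±1, ρ·h₂ = σ·log₂γ·α²·D` in `ℚ₂`;
  ★★ `quotient_law_chi4_valuation` — with `h₂ ≠ 0`: `D ≠ 0 ∧ v₂(D) + 2 = v₂(ρ) + v₂(h₂)`.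
* §5 (`d* = −2`, `n = 3`, `x = i`, `Ω = Ω⁻_f`, `D = L₂⁻′(f,ω,−2)`): ★★ `quotient_law_chi8'_padic`,
  ★★ `quotient_law_chi8'_valuation` (same shape).
`hρ` = Gross–Zagier I.(7.3) for the member + the period ratio `Ω_W/Ω⁻_{f_V}` (resp. `Ω_W·√2/Ω⁻_{f_V}`), displayed;
`h₂ ≠ 0` = Bertrand. Remaining for the defect key: `v₂(ρ)` (shaAn bookkeeping + period class constant), (Δ1).

References: D. Disegni, Compos. Math. 153 (2017) Thm. B [Disegni2017]; B. Perrin-Riou, Invent. Math. 89 (1987)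
§1 [PerrinRiou1987]; B. Mazur, J. Tate, J. Teitelbaum, Invent. Math. 84 (1986) §I.13 [MazurTateTeitelbaum1986Invent].
-/

set_option autoImplicit false
set_option linter.dupNamespace false

noncomputable section

open scoped Classical MatrixGroups ModularForm NumberField

open CongruenceSubgroup NumberField IsDedekindDomain WeierstrassCurve WeierstrassCurve.Affine.Point
  Literature.NumberTheory.EllipticCurves Literature.NumberTheory.EllipticCurves.ModularForms
  Literature.NumberTheory.EllipticCurves.Disegni2017 Literature.NumberTheory.GaloisRepresentations
  Summit.BirchSwinnertonDyer.Rank1Residual.AdditivePotMult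

namespace Summit.BirchSwinnertonDyer.BirchSwinnertonDyer.Theorems.PrintCf2.DisegniPairTwo

/-! ### §4 `d* = −1`: the `χ₋₄∘N`-line (odd branch `L₂⁻(f,ω,T)` at `T = 0`) -/

section Chi4

variable (ι : PadicAlgCl 2 ≃+* ℂ) (K : Type) [Field K] [NumberField K] [IsGalois ℚ K]

/-- ★★ **THE QUOTIENT LAW on the `χ₋₄∘N`-line AS AN IDENTITY IN `ℚ₂`** (`d* = −1`). Same frame and hypotheses
as `quotient_law_chi4_companion_free`, plus the archimedean rationality input
`hρ : L′(W,1)·τ(χ₋₄)·i = ρ·ĥ(P)·Ω⁻_f` with `ρ ∈ ℚ` (`τ(χ₋₄)·i = −2`; Gross–Zagier I.(7.3) for the member + the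
period ratio `Ω_W/Ω⁻_{f_V} ∈ ℚ`). Conclusion: `ρ·h₂ = σ·log₂γ·α²·[T¹]L₂⁻(f,ω,T)` in `ℚ₂` for a sign `σ`.
[cite: Disegni2017, Theorem B (arXiv v3 PDF p. 8)] [cite: PerrinRiou1987, §1]
[cite: MazurTateTeitelbaum1986Invent, §I.13–I.14] -/
theorem quotient_law_chi4_padic (h2 : Module.finrank ℚ K = 2)
    (hsplit : ((Ideal.span {(2 : ℤ)}).primesOver (𝓞 K)).ncard = 2)
    (𝔭 𝔭' : HeightOneSpectrum (𝓞 K)) (h𝔭 : ((2 : ℕ) : 𝓞 K) ∈ 𝔭.asIdeal)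
    (h𝔭' : ((2 : ℕ) : 𝓞 K) ∈ 𝔭'.asIdeal)
    (κ : DirichletCharacter ℂ (NumberField.discr K).natAbs)
    (hκ : ∀ ℓ : ℕ, ℓ.Prime → ℓ ≠ 2 → κ ℓ = (jacobiSym (NumberField.discr K) ℓ : ℂ))
    (hκ2 : κ 2 = if NumberField.discr K % 8 = 1 then 1 else if NumberField.discr K % 8 = 5 then -1 else 0)
    (hd : Nat.Coprime 2 (NumberField.discr K).natAbs)
    -- the good pair
    (V V' : WeierstrassCurve ℚ) [V.IsElliptic] [V.IsGloballyMinimal] [V'.IsElliptic] [V'.IsGloballyMinimal]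
    (hordV : IsOrdinaryAt V 2) (hordV' : IsOrdinaryAt V' 2) (hap : V'.frobeniusTrace 2 = V.frobeniusTrace 2)
    {N N' : ℕ} [NeZero N] [NeZero N'] {f : CuspForm (Gamma0 N) 2}
    {f' : CuspForm (Gamma0 N') 2} (hfV : IsNewformOf V f) (hfV' : IsNewformOf V' f')
    (hV' : ∀ n : ℕ, cuspCoeff f' n = κ (n : ZMod _) * cuspCoeff f n)
    (h0 : PowerSeries.constantCoeff (padicLFunctionMinusBranch f (unitRoot V 2 : ℚ_[2]) 1) = 0)
    -- the member and its companion (archimedean side)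
    (hmod : hasEntireLFunction_rat) {M M' : ℕ} [NeZero M] [NeZero M']
    {g : CuspForm (Gamma0 M) 2} {g' : CuspForm (Gamma0 M') 2}
    (W W' : WeierstrassCurve ℚ) [W.IsElliptic] [W'.IsElliptic]
    (hg : IsNewformOf W g) (hg' : IsNewformOf W' g')
    (hgε : ∀ m : ℕ, cuspCoeff g m = (ZMod.χ₄.ringHomComp (Int.castRingHom ℂ)) m * cuspCoeff f m)
    (hg'ε : ∀ m : ℕ, cuspCoeff g' m = (ZMod.χ₄.ringHomComp (Int.castRingHom ℂ)) m * cuspCoeff f' m)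
    (hW1 : W.entireLFunction 1 = 0) (hL : deriv W.entireLFunction 1 ≠ 0) (hL' : W'.entireLFunction 1 ≠ 0)
    -- the tower frame and the sign character
    {H : Type} [Field H] [NumberField H] [Algebra K H] (hKH : Module.finrank K H = 2) {t : H}
    (htK : t ∉ Set.range (algebraMap K H)) (ht2 : t ^ 2 = algebraMap ℚ H (-1))
    (G : Subgroup (H ≃ₐ[ℚ] H)) (χ : G →* ℂˣ) (s : G → ℤ) (hs : ∀ σ, ((χ σ : ℂˣ) : ℂ) = (s σ : ℂ))
    (τ : H ≃ₐ[ℚ] H) (hτG : τ ∈ G) (hsτ : s ⟨τ, hτG⟩ = -1)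
    (hτK : ∀ a : K, τ (algebraMap K H a) = algebraMap K H a) (hτt : τ t = -t)
    {u : K} {e : ℚ} (hu : u ∉ Set.range (algebraMap ℚ K)) (hue : u ^ 2 = algebraMap ℚ K e)
    (c : K ≃ₐ[ℚ] K) (hcu : c u = -u)
    -- the member's Mordell–Weil data
    [(V.quadraticTwist (-1)).IsElliptic] {P : (V.quadraticTwist (-1)).toAffine.Point}
    (hgen : ∀ R : (V.quadraticTwist (-1)).toAffine.Point,
      ∃ (k : ℤ) (T : (V.quadraticTwist (-1)).toAffine.Point), IsOfFinAddOrder T ∧ R = k • P + T)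
    (htors : ∀ Q : ((V.quadraticTwist (-1)).quadraticTwist e).toAffine.Point, IsOfFinAddOrder Q)
    -- Disegni's datum: invariance, PIN, and the conjoined clauses (PRINT stub of the road)
    (DH : PAdicHeightDataK V 2 H)
    (hDH : ∀ (σ : G) (a b : (V.baseChange H).toAffine.Point),
      DH.pairing (pointGalHom V H σ.1 a) (pointGalHom V H σ.1 b) = DH.pairing a b)
    {h₂ : ℚ_[2]}
    (hpin : DH.pairing
      (twistPointEquivOver V (not_mem_range_rat_of_not_mem_range htK) ht2
        (QuadraticDescent.incl H (V.quadraticTwist (-1)) P))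
      (twistPointEquivOver V (not_mem_range_rat_of_not_mem_range htK) ht2
        (QuadraticDescent.incl H (V.quadraticTwist (-1)) P)) = h₂)
    (hGZ : ChiLineGrossZagierClauses ι K V H f (ι (((unitRoot V 2 : ℚ_[2]) : PadicAlgCl 2)))
      (baseChangeDirichlet K (ZMod.χ₄.ringHomComp (Int.castRingHom ℂ))) 𝔭 𝔭' G χ DH)
    -- the archimedean rationality input (GZ86 + period ratio)
    (ρ : ℚ) (hρ : deriv W.entireLFunction 1 *
      gaussSum (ZMod.χ₄.ringHomComp (Int.castRingHom ℂ) : DirichletCharacter ℂ (2 ^ 2))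
        (ZMod.stdAddChar (N := 2 ^ 2)) * Complex.I =
        (ρ : ℂ) * (canonicalHeight P : ℂ) * (minusPeriod f : ℂ)) :
    ∃ σ : ℤˣ, (ρ : ℚ_[2]) * h₂ =
      ((σ : ℤ) : ℚ_[2]) * padicLog 2 (cyclotomicGenerator 2) * (unitRoot V 2 : ℚ_[2]) ^ 2 *
        PowerSeries.coeff 1 (padicLFunctionMinusBranch f (unitRoot V 2 : ℚ_[2]) 1) := by
  obtain ⟨σ₀, hlaw⟩ := quotient_law_chi4_companion_free ι K h2 hsplit 𝔭 𝔭' h𝔭 h𝔭' κ hκ hκ2 hd V V' hordV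
    hordV' hap hfV hfV' hV' h0 hmod W W' hg hg' hgε hg'ε hW1 hL hL' hKH htK ht2 G χ s hs τ hτG hsτ hτK hτt
    hu hue c hcu hgen htors DH hDH hpin hGZ
  -- Disegni's interpolation factor at the primitive point `χ₋₄`: `Z° = u·(ι(α)⁻²·τ(χ₋₄))²`
  have hZ : zCirc (p := 2) (ι (((unitRoot V 2 : ℚ_[2]) : PadicAlgCl 2))) N
      (baseChangeDirichlet K (ZMod.χ₄.ringHomComp (Int.castRingHom ℂ))) 𝔭 𝔭' =
      (splitLocalConstant 2 : ℂ) * ((ι (((unitRoot V 2 : ℚ_[2]) : PadicAlgCl 2)))⁻¹ ^ 2 *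
        gaussSum (ZMod.χ₄.ringHomComp (Int.castRingHom ℂ) : DirichletCharacter ℂ (2 ^ 2))⁻¹
          (ZMod.stdAddChar (N := 2 ^ 2))) ^ 2 :=
    zCirc_baseChangeDirichlet_of_isPrimitive (p := 2) (K := K) h2 hsplit (n := 2) (by norm_num)
      (θ := (ZMod.χ₄.ringHomComp (Int.castRingHom ℂ) : DirichletCharacter ℂ (2 ^ 2))) chi4_isPrimitive _ N 𝔭 𝔭' h𝔭 h𝔭'
  rw [chi4_inv] at hZ
  rw [hZ] at hlaw
  -- non-vanishing of the cancelled constants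
  have hτ4 : gaussSum (ZMod.χ₄.ringHomComp (Int.castRingHom ℂ) : DirichletCharacter ℂ (2 ^ 2))
        (ZMod.stdAddChar (N := 2 ^ 2)) ≠ 0 :=
    gaussSum_stdAddChar_ne_zero chi4_isPrimitive
  have hα0 : (unitRoot V 2 : ℚ_[2]) ≠ 0 := (unitRoot_coe_spec (W := V) hordV).2.2
  refine ⟨-σ₀, ?_⟩
  have hcore := quotient_law_descends ι (p := 2) (L := deriv W.entireLFunction 1) (x := Complex.I)
    (hP := (canonicalHeight P : ℂ)) (Ω := (minusPeriod f : ℂ))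
    (τ := gaussSum (ZMod.χ₄.ringHomComp (Int.castRingHom ℂ) : DirichletCharacter ℂ (2 ^ 2))
        (ZMod.stdAddChar (N := 2 ^ 2)))
    (u := splitLocalConstant 2) (α := (unitRoot V 2 : ℚ_[2])) (h := h₂)
    (ℓ := padicLog 2 (cyclotomicGenerator 2)) (n := 2) (s := -(σ₀ : ℤ))
    (D := PowerSeries.coeff 1 (padicLFunctionMinusBranch f (unitRoot V 2 : ℚ_[2]) 1))
    (splitLocalConstant_ne_zero 2) hτ4 Complex.I_ne_zero hL hα0 (by
      rw [Int.cast_neg]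
      simpa only [mul_assoc] using hlaw) ρ (by exact hρ)
  rw [hcore, Units.val_neg]

/-- ★★ **THE VALUATION EQUATION on the `χ₋₄∘N`-line** (`d* = −1`): under the hypotheses of
`quotient_law_chi4_padic` and `h₂ ≠ 0` (Bertrand), `[T¹]L₂⁻(f,ω,T) ≠ 0` and
`v₂([T¹]L₂⁻(f,ω,T)) + 2 = v₂(ρ) + v₂(h₂)`. [cite: Disegni2017, Theorem B] [cite: PerrinRiou1987, §1]
[cite: MazurTateTeitelbaum1986Invent, §I.13] -/
theorem quotient_law_chi4_valuation (h2 : Module.finrank ℚ K = 2)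
    (hsplit : ((Ideal.span {(2 : ℤ)}).primesOver (𝓞 K)).ncard = 2)
    (𝔭 𝔭' : HeightOneSpectrum (𝓞 K)) (h𝔭 : ((2 : ℕ) : 𝓞 K) ∈ 𝔭.asIdeal)
    (h𝔭' : ((2 : ℕ) : 𝓞 K) ∈ 𝔭'.asIdeal)
    (κ : DirichletCharacter ℂ (NumberField.discr K).natAbs)
    (hκ : ∀ ℓ : ℕ, ℓ.Prime → ℓ ≠ 2 → κ ℓ = (jacobiSym (NumberField.discr K) ℓ : ℂ))
    (hκ2 : κ 2 = if NumberField.discr K % 8 = 1 then 1 else if NumberField.discr K % 8 = 5 then -1 else 0)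
    (hd : Nat.Coprime 2 (NumberField.discr K).natAbs)
    (V V' : WeierstrassCurve ℚ) [V.IsElliptic] [V.IsGloballyMinimal] [V'.IsElliptic] [V'.IsGloballyMinimal]
    (hordV : IsOrdinaryAt V 2) (hordV' : IsOrdinaryAt V' 2) (hap : V'.frobeniusTrace 2 = V.frobeniusTrace 2)
    {N N' : ℕ} [NeZero N] [NeZero N'] {f : CuspForm (Gamma0 N) 2}
    {f' : CuspForm (Gamma0 N') 2} (hfV : IsNewformOf V f) (hfV' : IsNewformOf V' f')
    (hV' : ∀ n : ℕ, cuspCoeff f' n = κ (n : ZMod _) * cuspCoeff f n)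
    (h0 : PowerSeries.constantCoeff (padicLFunctionMinusBranch f (unitRoot V 2 : ℚ_[2]) 1) = 0)
    (hmod : hasEntireLFunction_rat) {M M' : ℕ} [NeZero M] [NeZero M']
    {g : CuspForm (Gamma0 M) 2} {g' : CuspForm (Gamma0 M') 2}
    (W W' : WeierstrassCurve ℚ) [W.IsElliptic] [W'.IsElliptic]
    (hg : IsNewformOf W g) (hg' : IsNewformOf W' g')
    (hgε : ∀ m : ℕ, cuspCoeff g m = (ZMod.χ₄.ringHomComp (Int.castRingHom ℂ)) m * cuspCoeff f m)
    (hg'ε : ∀ m : ℕ, cuspCoeff g' m = (ZMod.χ₄.ringHomComp (Int.castRingHom ℂ)) m * cuspCoeff f' m)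
    (hW1 : W.entireLFunction 1 = 0) (hL : deriv W.entireLFunction 1 ≠ 0) (hL' : W'.entireLFunction 1 ≠ 0)
    {H : Type} [Field H] [NumberField H] [Algebra K H] (hKH : Module.finrank K H = 2) {t : H}
    (htK : t ∉ Set.range (algebraMap K H)) (ht2 : t ^ 2 = algebraMap ℚ H (-1))
    (G : Subgroup (H ≃ₐ[ℚ] H)) (χ : G →* ℂˣ) (s : G → ℤ) (hs : ∀ σ, ((χ σ : ℂˣ) : ℂ) = (s σ : ℂ))
    (τ : H ≃ₐ[ℚ] H) (hτG : τ ∈ G) (hsτ : s ⟨τ, hτG⟩ = -1)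
    (hτK : ∀ a : K, τ (algebraMap K H a) = algebraMap K H a) (hτt : τ t = -t)
    {u : K} {e : ℚ} (hu : u ∉ Set.range (algebraMap ℚ K)) (hue : u ^ 2 = algebraMap ℚ K e)
    (c : K ≃ₐ[ℚ] K) (hcu : c u = -u)
    [(V.quadraticTwist (-1)).IsElliptic] {P : (V.quadraticTwist (-1)).toAffine.Point}
    (hgen : ∀ R : (V.quadraticTwist (-1)).toAffine.Point,
      ∃ (k : ℤ) (T : (V.quadraticTwist (-1)).toAffine.Point), IsOfFinAddOrder T ∧ R = k • P + T)
    (htors : ∀ Q : ((V.quadraticTwist (-1)).quadraticTwist e).toAffine.Point, IsOfFinAddOrder Q)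
    (DH : PAdicHeightDataK V 2 H)
    (hDH : ∀ (σ : G) (a b : (V.baseChange H).toAffine.Point),
      DH.pairing (pointGalHom V H σ.1 a) (pointGalHom V H σ.1 b) = DH.pairing a b)
    {h₂ : ℚ_[2]}
    (hpin : DH.pairing
      (twistPointEquivOver V (not_mem_range_rat_of_not_mem_range htK) ht2
        (QuadraticDescent.incl H (V.quadraticTwist (-1)) P))
      (twistPointEquivOver V (not_mem_range_rat_of_not_mem_range htK) ht2
        (QuadraticDescent.incl H (V.quadraticTwist (-1)) P)) = h₂)
    (hGZ : ChiLineGrossZagierClauses ι K V H f (ι (((unitRoot V 2 : ℚ_[2]) : PadicAlgCl 2)))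
      (baseChangeDirichlet K (ZMod.χ₄.ringHomComp (Int.castRingHom ℂ))) 𝔭 𝔭' G χ DH)
    (ρ : ℚ) (hρ : deriv W.entireLFunction 1 *
      gaussSum (ZMod.χ₄.ringHomComp (Int.castRingHom ℂ) : DirichletCharacter ℂ (2 ^ 2))
        (ZMod.stdAddChar (N := 2 ^ 2)) * Complex.I =
        (ρ : ℂ) * (canonicalHeight P : ℂ) * (minusPeriod f : ℂ))
    -- Bertrand: the 2-adic height of the member's generator is non-zero
    (hh₂ : h₂ ≠ 0) :
    PowerSeries.coeff 1 (padicLFunctionMinusBranch f (unitRoot V 2 : ℚ_[2]) 1) ≠ 0 ∧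
      (PowerSeries.coeff 1 (padicLFunctionMinusBranch f (unitRoot V 2 : ℚ_[2]) 1)).valuation + 2 =
        padicValRat 2 ρ + h₂.valuation := by
  obtain ⟨σ, hlaw⟩ := quotient_law_chi4_padic ι K h2 hsplit 𝔭 𝔭' h𝔭 h𝔭' κ hκ hκ2 hd V V' hordV
    hordV' hap hfV hfV' hV' h0 hmod W W' hg hg' hgε hg'ε hW1 hL hL' hKH htK ht2 G χ s hs τ hτG hsτ hτK hτt
    hu hue c hcu hgen htors DH hDH hpin hGZ ρ hρ
  have hτ4 : gaussSum (ZMod.χ₄.ringHomComp (Int.castRingHom ℂ) : DirichletCharacter ℂ (2 ^ 2))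
        (ZMod.stdAddChar (N := 2 ^ 2)) ≠ 0 :=
    gaussSum_stdAddChar_ne_zero chi4_isPrimitive
  have hρ0 : ρ ≠ 0 := by
    intro hρ0
    rw [hρ0, Rat.cast_zero, zero_mul, zero_mul] at hρ
    exact (mul_ne_zero (mul_ne_zero hL hτ4) Complex.I_ne_zero) hρ
  rw [← valuation_padicLog_cyclotomicGenerator_two]
  exact valuation_eq_of_rat_mul_eq hlaw (unitRoot_coe_spec (W := V) hordV).2.1 hρ0 hh₂
    padicLog_cyclotomicGenerator_two_ne_zero

end Chi4

/-! ### §5 `d* = −2`: the `χ₋₈∘N`-line (odd branch `L₂⁻(f,ω,T)` at `T = −2`) -/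

section Chi8Prime

variable (ι : PadicAlgCl 2 ≃+* ℂ) (K : Type) [Field K] [NumberField K] [IsGalois ℚ K]

/-- ★★ **THE QUOTIENT LAW on the `χ₋₈∘N`-line AS AN IDENTITY IN `ℚ₂`** (`d* = −2`). Same frame and hypotheses
as `quotient_law_chi8'_companion_free`, plus the archimedean rationality input
`hρ : L′(W,1)·τ(χ₋₈)·i = ρ·ĥ(P)·Ω⁻_f` with `ρ ∈ ℚ` (`τ(χ₋₈)·i = −2√2`; Gross–Zagier I.(7.3) for the member + the
period ratio `Ω_W·√2/Ω⁻_{f_V} ∈ ℚ`). Conclusion: `ρ·h₂ = σ·log₂γ·α³·L₂⁻′(f,ω,−2)` in `ℚ₂` for a sign `σ`,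
`L₂⁻′(f,ω,−2) = Σ_k k[T^k]L₂⁻(f,ω,T)(−2)^{k−1}`. [cite: Disegni2017, Theorem B (arXiv v3 PDF p. 8)]
[cite: PerrinRiou1987, §1] [cite: MazurTateTeitelbaum1986Invent, §I.13–I.14] -/
theorem quotient_law_chi8'_padic (h2 : Module.finrank ℚ K = 2)
    (hsplit : ((Ideal.span {(2 : ℤ)}).primesOver (𝓞 K)).ncard = 2)
    (𝔭 𝔭' : HeightOneSpectrum (𝓞 K)) (h𝔭 : ((2 : ℕ) : 𝓞 K) ∈ 𝔭.asIdeal)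
    (h𝔭' : ((2 : ℕ) : 𝓞 K) ∈ 𝔭'.asIdeal)
    (κ : DirichletCharacter ℂ (NumberField.discr K).natAbs)
    (hκ : ∀ ℓ : ℕ, ℓ.Prime → ℓ ≠ 2 → κ ℓ = (jacobiSym (NumberField.discr K) ℓ : ℂ))
    (hκ2 : κ 2 = if NumberField.discr K % 8 = 1 then 1 else if NumberField.discr K % 8 = 5 then -1 else 0)
    (hd : Nat.Coprime 2 (NumberField.discr K).natAbs)
    -- the good pair
    (V V' : WeierstrassCurve ℚ) [V.IsElliptic] [V.IsGloballyMinimal] [V'.IsElliptic] [V'.IsGloballyMinimal]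
    (hordV : IsOrdinaryAt V 2) (hordV' : IsOrdinaryAt V' 2) (hap : V'.frobeniusTrace 2 = V.frobeniusTrace 2)
    {N N' : ℕ} [NeZero N] [NeZero N'] {f : CuspForm (Gamma0 N) 2}
    {f' : CuspForm (Gamma0 N') 2} (hfV : IsNewformOf V f) (hfV' : IsNewformOf V' f')
    (hV' : ∀ n : ℕ, cuspCoeff f' n = κ (n : ZMod _) * cuspCoeff f n)
    (h0 : HasSum (fun k : ℕ ↦ PowerSeries.coeff k (padicLFunctionMinusBranch f (unitRoot V 2 : ℚ_[2]) 1) *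
      (-2 : ℚ_[2]) ^ k) 0)
    -- the member and its companion (archimedean side)
    (hmod : hasEntireLFunction_rat) {M M' : ℕ} [NeZero M] [NeZero M']
    {g : CuspForm (Gamma0 M) 2} {g' : CuspForm (Gamma0 M') 2}
    (W W' : WeierstrassCurve ℚ) [W.IsElliptic] [W'.IsElliptic]
    (hg : IsNewformOf W g) (hg' : IsNewformOf W' g')
    (hgε : ∀ m : ℕ, cuspCoeff g m = (ZMod.χ₈'.ringHomComp (Int.castRingHom ℂ)) m * cuspCoeff f m)
    (hg'ε : ∀ m : ℕ, cuspCoeff g' m = (ZMod.χ₈'.ringHomComp (Int.castRingHom ℂ)) m * cuspCoeff f' m)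
    (hW1 : W.entireLFunction 1 = 0) (hL : deriv W.entireLFunction 1 ≠ 0) (hL' : W'.entireLFunction 1 ≠ 0)
    -- the tower frame and the sign character
    {H : Type} [Field H] [NumberField H] [Algebra K H] (hKH : Module.finrank K H = 2) {t : H}
    (htK : t ∉ Set.range (algebraMap K H)) (ht2 : t ^ 2 = algebraMap ℚ H (-2))
    (G : Subgroup (H ≃ₐ[ℚ] H)) (χ : G →* ℂˣ) (s : G → ℤ) (hs : ∀ σ, ((χ σ : ℂˣ) : ℂ) = (s σ : ℂ))
    (τ : H ≃ₐ[ℚ] H) (hτG : τ ∈ G) (hsτ : s ⟨τ, hτG⟩ = -1)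
    (hτK : ∀ a : K, τ (algebraMap K H a) = algebraMap K H a) (hτt : τ t = -t)
    {u : K} {e : ℚ} (hu : u ∉ Set.range (algebraMap ℚ K)) (hue : u ^ 2 = algebraMap ℚ K e)
    (c : K ≃ₐ[ℚ] K) (hcu : c u = -u)
    -- the member's Mordell–Weil data
    [(V.quadraticTwist (-2)).IsElliptic] {P : (V.quadraticTwist (-2)).toAffine.Point}
    (hgen : ∀ R : (V.quadraticTwist (-2)).toAffine.Point,
      ∃ (k : ℤ) (T : (V.quadraticTwist (-2)).toAffine.Point), IsOfFinAddOrder T ∧ R = k • P + T)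
    (htors : ∀ Q : ((V.quadraticTwist (-2)).quadraticTwist e).toAffine.Point, IsOfFinAddOrder Q)
    -- Disegni's datum: invariance, PIN, and the conjoined clauses (PRINT stub of the road)
    (DH : PAdicHeightDataK V 2 H)
    (hDH : ∀ (σ : G) (a b : (V.baseChange H).toAffine.Point),
      DH.pairing (pointGalHom V H σ.1 a) (pointGalHom V H σ.1 b) = DH.pairing a b)
    {h₂ : ℚ_[2]}
    (hpin : DH.pairing
      (twistPointEquivOver V (not_mem_range_rat_of_not_mem_range htK) ht2
        (QuadraticDescent.incl H (V.quadraticTwist (-2)) P))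
      (twistPointEquivOver V (not_mem_range_rat_of_not_mem_range htK) ht2
        (QuadraticDescent.incl H (V.quadraticTwist (-2)) P)) = h₂)
    (hGZ : ChiLineGrossZagierClauses ι K V H f (ι (((unitRoot V 2 : ℚ_[2]) : PadicAlgCl 2)))
      (baseChangeDirichlet K (ZMod.χ₈'.ringHomComp (Int.castRingHom ℂ))) 𝔭 𝔭' G χ DH)
    -- the archimedean rationality input (GZ86 + period ratio)
    (ρ : ℚ) (hρ : deriv W.entireLFunction 1 *
      gaussSum (ZMod.χ₈'.ringHomComp (Int.castRingHom ℂ) : DirichletCharacter ℂ (2 ^ (2 + 1)))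
        (ZMod.stdAddChar (N := 2 ^ (2 + 1))) * Complex.I =
        (ρ : ℂ) * (canonicalHeight P : ℂ) * (minusPeriod f : ℂ)) :
    ∃ σ : ℤˣ, (ρ : ℚ_[2]) * h₂ =
      ((σ : ℤ) : ℚ_[2]) * padicLog 2 (cyclotomicGenerator 2) * (unitRoot V 2 : ℚ_[2]) ^ 3 *
        (∑' k : ℕ, PowerSeries.coeff k
        (padicLFunctionMinusBranch f (unitRoot V 2 : ℚ_[2]) 1) * (k : ℚ_[2]) * (-2) ^ (k - 1)) := by
  obtain ⟨σ₀, hlaw⟩ := quotient_law_chi8'_companion_free ι K h2 hsplit 𝔭 𝔭' h𝔭 h𝔭' κ hκ hκ2 hd V V' hordV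
    hordV' hap hfV hfV' hV' h0 hmod W W' hg hg' hgε hg'ε hW1 hL hL' hKH htK ht2 G χ s hs τ hτG hsτ hτK hτt
    hu hue c hcu hgen htors DH hDH hpin hGZ
  -- Disegni's interpolation factor at the primitive point `χ₋₈`: `Z° = u·(ι(α)⁻³·τ(χ₋₈))²`
  have hinv : (ZMod.χ₈'.ringHomComp (Int.castRingHom ℂ) : DirichletCharacter ℂ (2 ^ (2 + 1)))⁻¹ =
      (ZMod.χ₈'.ringHomComp (Int.castRingHom ℂ) : DirichletCharacter ℂ (2 ^ (2 + 1))) :=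
    (ZMod.isQuadratic_χ₈'.comp (Int.castRingHom ℂ)).inv
  have hZ : zCirc (p := 2) (ι (((unitRoot V 2 : ℚ_[2]) : PadicAlgCl 2))) N
      (baseChangeDirichlet K (ZMod.χ₈'.ringHomComp (Int.castRingHom ℂ))) 𝔭 𝔭' =
      (splitLocalConstant 2 : ℂ) * ((ι (((unitRoot V 2 : ℚ_[2]) : PadicAlgCl 2)))⁻¹ ^ (2 + 1) *
        gaussSum (ZMod.χ₈'.ringHomComp (Int.castRingHom ℂ) : DirichletCharacter ℂ (2 ^ (2 + 1)))⁻¹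
          (ZMod.stdAddChar (N := 2 ^ (2 + 1)))) ^ 2 :=
    zCirc_baseChangeDirichlet_of_isPrimitive (p := 2) (K := K) h2 hsplit (n := 2 + 1) (by norm_num)
      (θ := (ZMod.χ₈'.ringHomComp (Int.castRingHom ℂ) : DirichletCharacter ℂ (2 ^ (2 + 1)))) isPrimitive_χ₈'_ringHomComp _ N 𝔭 𝔭' h𝔭 h𝔭'
  rw [hinv] at hZ
  rw [hZ] at hlaw
  -- non-vanishing of the cancelled constants
  have hτ8 : gaussSum (ZMod.χ₈'.ringHomComp (Int.castRingHom ℂ) : DirichletCharacter ℂ (2 ^ (2 + 1)))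
        (ZMod.stdAddChar (N := 2 ^ (2 + 1))) ≠ 0 :=
    gaussSum_stdAddChar_ne_zero isPrimitive_χ₈'_ringHomComp
  have hα0 : (unitRoot V 2 : ℚ_[2]) ≠ 0 := (unitRoot_coe_spec (W := V) hordV).2.2
  refine ⟨σ₀, ?_⟩
  have hcore := quotient_law_descends ι (p := 2) (L := deriv W.entireLFunction 1) (x := Complex.I)
    (hP := (canonicalHeight P : ℂ)) (Ω := (minusPeriod f : ℂ))
    (τ := gaussSum (ZMod.χ₈'.ringHomComp (Int.castRingHom ℂ) : DirichletCharacter ℂ (2 ^ (2 + 1)))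
        (ZMod.stdAddChar (N := 2 ^ (2 + 1))))
    (u := splitLocalConstant 2) (α := (unitRoot V 2 : ℚ_[2])) (h := h₂)
    (ℓ := padicLog 2 (cyclotomicGenerator 2)) (n := 2 + 1) (s := (σ₀ : ℤ))
    (D := (∑' k : ℕ, PowerSeries.coeff k
        (padicLFunctionMinusBranch f (unitRoot V 2 : ℚ_[2]) 1) * (k : ℚ_[2]) * (-2) ^ (k - 1)))
    (splitLocalConstant_ne_zero 2) hτ8 Complex.I_ne_zero hL hα0 (by
      simpa only [mul_assoc] using hlaw) ρ (by exact hρ)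
  rw [hcore]

/-- ★★ **THE VALUATION EQUATION on the `χ₋₈∘N`-line** (`d* = −2`): under the hypotheses of
`quotient_law_chi8'_padic` and `h₂ ≠ 0` (Bertrand), `L₂⁻′(f,ω,−2) ≠ 0` and
`v₂(L₂⁻′(f,ω,−2)) + 2 = v₂(ρ) + v₂(h₂)`. [cite: Disegni2017, Theorem B] [cite: PerrinRiou1987, §1]
[cite: MazurTateTeitelbaum1986Invent, §I.13] -/
theorem quotient_law_chi8'_valuation (h2 : Module.finrank ℚ K = 2)
    (hsplit : ((Ideal.span {(2 : ℤ)}).primesOver (𝓞 K)).ncard = 2)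
    (𝔭 𝔭' : HeightOneSpectrum (𝓞 K)) (h𝔭 : ((2 : ℕ) : 𝓞 K) ∈ 𝔭.asIdeal)
    (h𝔭' : ((2 : ℕ) : 𝓞 K) ∈ 𝔭'.asIdeal)
    (κ : DirichletCharacter ℂ (NumberField.discr K).natAbs)
    (hκ : ∀ ℓ : ℕ, ℓ.Prime → ℓ ≠ 2 → κ ℓ = (jacobiSym (NumberField.discr K) ℓ : ℂ))
    (hκ2 : κ 2 = if NumberField.discr K % 8 = 1 then 1 else if NumberField.discr K % 8 = 5 then -1 else 0)
    (hd : Nat.Coprime 2 (NumberField.discr K).natAbs)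
    (V V' : WeierstrassCurve ℚ) [V.IsElliptic] [V.IsGloballyMinimal] [V'.IsElliptic] [V'.IsGloballyMinimal]
    (hordV : IsOrdinaryAt V 2) (hordV' : IsOrdinaryAt V' 2) (hap : V'.frobeniusTrace 2 = V.frobeniusTrace 2)
    {N N' : ℕ} [NeZero N] [NeZero N'] {f : CuspForm (Gamma0 N) 2}
    {f' : CuspForm (Gamma0 N') 2} (hfV : IsNewformOf V f) (hfV' : IsNewformOf V' f')
    (hV' : ∀ n : ℕ, cuspCoeff f' n = κ (n : ZMod _) * cuspCoeff f n)
    (h0 : HasSum (fun k : ℕ ↦ PowerSeries.coeff k (padicLFunctionMinusBranch f (unitRoot V 2 : ℚ_[2]) 1) *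
      (-2 : ℚ_[2]) ^ k) 0)
    (hmod : hasEntireLFunction_rat) {M M' : ℕ} [NeZero M] [NeZero M']
    {g : CuspForm (Gamma0 M) 2} {g' : CuspForm (Gamma0 M') 2}
    (W W' : WeierstrassCurve ℚ) [W.IsElliptic] [W'.IsElliptic]
    (hg : IsNewformOf W g) (hg' : IsNewformOf W' g')
    (hgε : ∀ m : ℕ, cuspCoeff g m = (ZMod.χ₈'.ringHomComp (Int.castRingHom ℂ)) m * cuspCoeff f m)
    (hg'ε : ∀ m : ℕ, cuspCoeff g' m = (ZMod.χ₈'.ringHomComp (Int.castRingHom ℂ)) m * cuspCoeff f' m)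
    (hW1 : W.entireLFunction 1 = 0) (hL : deriv W.entireLFunction 1 ≠ 0) (hL' : W'.entireLFunction 1 ≠ 0)
    {H : Type} [Field H] [NumberField H] [Algebra K H] (hKH : Module.finrank K H = 2) {t : H}
    (htK : t ∉ Set.range (algebraMap K H)) (ht2 : t ^ 2 = algebraMap ℚ H (-2))
    (G : Subgroup (H ≃ₐ[ℚ] H)) (χ : G →* ℂˣ) (s : G → ℤ) (hs : ∀ σ, ((χ σ : ℂˣ) : ℂ) = (s σ : ℂ))
    (τ : H ≃ₐ[ℚ] H) (hτG : τ ∈ G) (hsτ : s ⟨τ, hτG⟩ = -1)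
    (hτK : ∀ a : K, τ (algebraMap K H a) = algebraMap K H a) (hτt : τ t = -t)
    {u : K} {e : ℚ} (hu : u ∉ Set.range (algebraMap ℚ K)) (hue : u ^ 2 = algebraMap ℚ K e)
    (c : K ≃ₐ[ℚ] K) (hcu : c u = -u)
    [(V.quadraticTwist (-2)).IsElliptic] {P : (V.quadraticTwist (-2)).toAffine.Point}
    (hgen : ∀ R : (V.quadraticTwist (-2)).toAffine.Point,
      ∃ (k : ℤ) (T : (V.quadraticTwist (-2)).toAffine.Point), IsOfFinAddOrder T ∧ R = k • P + T)
    (htors : ∀ Q : ((V.quadraticTwist (-2)).quadraticTwist e).toAffine.Point, IsOfFinAddOrder Q)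
    (DH : PAdicHeightDataK V 2 H)
    (hDH : ∀ (σ : G) (a b : (V.baseChange H).toAffine.Point),
      DH.pairing (pointGalHom V H σ.1 a) (pointGalHom V H σ.1 b) = DH.pairing a b)
    {h₂ : ℚ_[2]}
    (hpin : DH.pairing
      (twistPointEquivOver V (not_mem_range_rat_of_not_mem_range htK) ht2
        (QuadraticDescent.incl H (V.quadraticTwist (-2)) P))
      (twistPointEquivOver V (not_mem_range_rat_of_not_mem_range htK) ht2
        (QuadraticDescent.incl H (V.quadraticTwist (-2)) P)) = h₂)
    (hGZ : ChiLineGrossZagierClauses ι K V H f (ι (((unitRoot V 2 : ℚ_[2]) : PadicAlgCl 2)))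
      (baseChangeDirichlet K (ZMod.χ₈'.ringHomComp (Int.castRingHom ℂ))) 𝔭 𝔭' G χ DH)
    (ρ : ℚ) (hρ : deriv W.entireLFunction 1 *
      gaussSum (ZMod.χ₈'.ringHomComp (Int.castRingHom ℂ) : DirichletCharacter ℂ (2 ^ (2 + 1)))
        (ZMod.stdAddChar (N := 2 ^ (2 + 1))) * Complex.I =
        (ρ : ℂ) * (canonicalHeight P : ℂ) * (minusPeriod f : ℂ))
    -- Bertrand: the 2-adic height of the member's generator is non-zero
    (hh₂ : h₂ ≠ 0) :
    (∑' k : ℕ, PowerSeries.coeff k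
        (padicLFunctionMinusBranch f (unitRoot V 2 : ℚ_[2]) 1) * (k : ℚ_[2]) * (-2) ^ (k - 1)) ≠ 0 ∧
      (∑' k : ℕ, PowerSeries.coeff k
        (padicLFunctionMinusBranch f (unitRoot V 2 : ℚ_[2]) 1) * (k : ℚ_[2]) * (-2) ^ (k - 1)).valuation + 2 =
        padicValRat 2 ρ + h₂.valuation := by
  obtain ⟨σ, hlaw⟩ := quotient_law_chi8'_padic ι K h2 hsplit 𝔭 𝔭' h𝔭 h𝔭' κ hκ hκ2 hd V V' hordV
    hordV' hap hfV hfV' hV' h0 hmod W W' hg hg' hgε hg'ε hW1 hL hL' hKH htK ht2 G χ s hs τ hτG hsτ hτK hτt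
    hu hue c hcu hgen htors DH hDH hpin hGZ ρ hρ
  have hτ8 : gaussSum (ZMod.χ₈'.ringHomComp (Int.castRingHom ℂ) : DirichletCharacter ℂ (2 ^ (2 + 1)))
        (ZMod.stdAddChar (N := 2 ^ (2 + 1))) ≠ 0 :=
    gaussSum_stdAddChar_ne_zero isPrimitive_χ₈'_ringHomComp
  have hρ0 : ρ ≠ 0 := by
    intro hρ0
    rw [hρ0, Rat.cast_zero, zero_mul, zero_mul] at hρ
    exact (mul_ne_zero (mul_ne_zero hL hτ8) Complex.I_ne_zero) hρ
  rw [← valuation_padicLog_cyclotomicGenerator_two]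
  exact valuation_eq_of_rat_mul_eq hlaw (unitRoot_coe_spec (W := V) hordV).2.1 hρ0 hh₂
    padicLog_cyclotomicGenerator_two_ne_zero

end Chi8Prime

end Summit.BirchSwinnertonDyer.BirchSwinnertonDyer.Theorems.PrintCf2.DisegniPairTwo

end
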